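import Summits.CriticalPhenomena.Ising3DConformalLimit.Theses.PerfectScreening
import Summits.CriticalPhenomena.Ising3DConformalLimit.Theorems.CoulombImpliesNontrivial.Negative.LatticeShadow

/-!
# `CoulombImpliesNontrivial` (item stmt-CriticalPhenomena-13885), line `CoulombBranchIsFree`: both lattice shadows are false

Companion of `PerfectScreeningCoulombImpliesNontrivialCoulombBranchIsFree.lean` (R1–R5'); THEOREM-ONLY.
By R5' there, `r3 ⟺ r3' ∧ clause₂'` with r3' = "a Möbius non-degenerate pointwise limit of `criticalCorr 3` forces
`NonSaturation`" (`¬GFP⁺`) and clause₂' = "under Coulomb every non-degenerate limit agreeing on `NonCoincident` with no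
Möbius family is interacting". This file shows that the LATTICE SHADOW of each conjunct — the same statement for an
ARBITRARY lattice family `G` with a two-sided Coulomb two-point function `c/‖x‖ ≤ G₂(0,x) ≤ C/‖x‖` in place of
`criticalCorr 3` — is FALSE, so each needs Ising DYNAMICS (currents / `σ² = 1` / Lee–Yang / DLR), not kinematics:

* `latticeShadow_moebiusForcesScreening_false` (**R6**, crux-ideate round 2, ideator 5): the massless free family
  `gffFamily (1/2)` sampled on `ℤ³` (`sampleOnLattice`, `hasPointwiseScalingLimit_gff_sample`) has two-sided Coulomb
  two-point function and the free MÖBIUS limit `gffFamily (1/2)` under `ρ = δ^{-1/2}`.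
* `latticeShadow_faithfulNonMoebiusClause_false` (**R7**, lead a2): the ANISOTROPIC massless free family
  `x ↦ gffFamily (1/2) (L x)`, `L v = v + ⟨v, e₂⟩ e₂` (`‖v‖ ≤ ‖L v‖ ≤ 2‖v‖`), sampled on `ℤ³`, has two-sided Coulomb
  two-point function (`1/(4‖x‖) ≤ G₂ ≤ 1/‖x‖`) and a genuine non-degenerate WICK pointwise limit (itself, `Δ = 1/2`
  scale covariant) that agrees on `NonCoincident` with NO Möbius-covariant family: `S₂(0,e₀) = 1 ≠ 1/2 = S₂(0,e₂)`
  against rotation invariance. So beyond `¬GFP⁺` the crux r3 also demands "η = 0 ⟹ every NON-conformal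
  non-degenerate limit is interacting" (emergent conformality or interaction of all η = 0 limits) — a clause
  `PerfectScreening.closes` never uses, and one kinematics cannot supply either.
-/

noncomputable section

namespace Summit.CriticalPhenomena.Ising3DConformalLimit.PerfectScreeningCoulombImpliesNontrivial.CoulombBranchIsFree

open Literature.Probability.LatticeModels Filter Set
open Summit.CriticalPhenomena.Ising3DConformalLimit.CoulombImpliesNontrivialNegative
open scoped Topology RealInnerProductSpace

/-! ### R6 — the lattice shadow of r3' is false (ideator 5) -/

/-- **R6. The LATTICE SHADOW of r3' is false**: for an ARBITRARY lattice family with a two-sided Coulomb two-point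
function, "Möbius non-degenerate pointwise limit ⟹ contradiction" fails — the massless free family sampled on `ℤ³`
has the free Möbius limit `gffFamily (1/2)` under `ρ = δ^{-1/2}` (`hasPointwiseScalingLimit_gff_sample`). Hence any
proof of r3' (a fortiori of r3) must use Ising DYNAMICS (currents, `σ² = 1`, Lee–Yang, DLR), not kinematics. [cite: FrancescoMathieuSenechal1997, §4.3.1] -/
theorem latticeShadow_moebiusForcesScreening_false : ¬ ∀ G : LatticeCorrFamily 3, (∃ c : ℝ, 0 < c ∧ ∀ x : Site 3, x ≠ 0 → c / ‖x‖ ≤ G 2 ![0, x]) → (∃ C : ℝ, ∀ x : Site 3, x ≠ 0 → G 2 ![0, x] ≤ C / ‖x‖) → ∀ (ρ : ℝ → ℝ) (Δ : ℝ) (S : CorrFamily 3), (∀ δ ∈ Set.Ioc (0:ℝ) 1, 0 < ρ δ) → HasPointwiseScalingLimit G ρ S → IsNondegenerateTwoPoint S → IsMoebiusCovariant Δ S → False := by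
  intro h
  refine h (sampleOnLattice (gffFamily (1/2))) ?_ ?_ (fun δ => δ ^ (-(1/2:ℝ))) (1/2)
    (gffFamily (1/2)) (fun δ hδ => Real.rpow_pos_of_pos hδ.1 _) (hasPointwiseScalingLimit_gff_sample (1/2))
    (isNondegenerateTwoPoint_gff _) (isMoebiusCovariant_gff _)
  · refine ⟨1/2, by norm_num, fun x hx => ?_⟩
    rw [sampleOnLattice_gff_half_two]
    have hx1 : (0:ℝ) < ‖x‖ := norm_pos_iff.2 hx
    have h2 := norm_siteVec_le x
    have hpos : 0 < ‖siteVec x‖ := hx1.trans_le (norm_le_norm_siteVec x)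
    rw [div_le_div_iff₀ hx1 hpos]
    linarith
  · refine ⟨1, fun x hx => ?_⟩
    rw [sampleOnLattice_gff_half_two]
    have hx1 : (0:ℝ) < ‖x‖ := norm_pos_iff.2 hx
    exact one_div_le_one_div_of_le hx1 (norm_le_norm_siteVec x)

/-! ### R7 — the lattice shadow of the faithful non-Möbius clause is false too (anisotropic free family) -/

/-- **R7. The lattice shadow of the FAITHFUL non-Möbius conjunct is false**: an arbitrary lattice family with a
two-sided Coulomb two-point function CAN have a non-degenerate WICK pointwise limit that agrees on `NonCoincident`
with no Möbius-covariant family — the anisotropic massless free family `x ↦ gffFamily (1/2) (L x)` with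
`L v = v + ⟨v, e₂⟩ e₂` (so `‖v‖ ≤ ‖L v‖ ≤ 2‖v‖`), sampled on `ℤ³`, with limit itself under `ρ = δ^{-1/2}`: it is scale
covariant with `Δ = 1/2`, Wick, and `S₂(0,e₀) = 1 ≠ 1/2 = S₂(0,e₂)` contradicts rotation invariance of any Möbius
family agreeing with it on non-coincident pairs. So, beyond `¬GFP⁺`, r3 also demands interaction (or emergent
conformality) of NON-conformal η = 0 limits — and kinematics cannot supply that either. [cite: FrancescoMathieuSenechal1997, §4.3.1] -/
theorem latticeShadow_faithfulNonMoebiusClause_false : ¬ ∀ G : LatticeCorrFamily 3, (∃ c : ℝ, 0 < c ∧ ∀ x : Site 3, x ≠ 0 → c / ‖x‖ ≤ G 2 ![0, x]) → (∃ C : ℝ, ∀ x : Site 3, x ≠ 0 → G 2 ![0, x] ≤ C / ‖x‖) → ∀ (ρ : ℝ → ℝ) (S : CorrFamily 3), (∀ δ ∈ Set.Ioc (0:ℝ) 1, 0 < ρ δ) → HasPointwiseScalingLimit G ρ S → IsNondegenerateTwoPoint S → (∀ (Δ : ℝ) (S' : CorrFamily 3), IsMoebiusCovariant Δ S' → ¬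 ∀ n, (NonCoincident 3 n).EqOn (S n) (S' n)) → HasNontrivialU4 S := by
  intro h
  -- the anisotropy `L v = v + ⟨v, e⟩ e`, `e = e₂`
  set e : EuclideanSpace ℝ (Fin 3) := EuclideanSpace.single (2 : Fin 3) (1:ℝ) with he
  have hee : ‖e‖ = 1 := by simp [he]
  set L : EuclideanSpace ℝ (Fin 3) → EuclideanSpace ℝ (Fin 3) := fun v => v + ⟪v, e⟫ • e with hL
  have hLsmul : ∀ (c : ℝ) (v : EuclideanSpace ℝ (Fin 3)), L (c • v) = c • L v := by
    intro c v
    simp only [hL, real_inner_smul_left, smul_add, smul_smul]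
  have hLsub : ∀ a b : EuclideanSpace ℝ (Fin 3), L a - L b = L (a - b) := by
    intro a b
    simp only [hL, inner_sub_left, sub_smul]
    abel
  have hLsq : ∀ v : EuclideanSpace ℝ (Fin 3), ‖L v‖ ^ 2 = ‖v‖ ^ 2 + 3 * ⟪v, e⟫ ^ 2 := by
    intro v
    simp only [hL]
    rw [norm_add_sq_real, norm_smul, real_inner_smul_right, hee, Real.norm_eq_abs, mul_one, sq_abs]
    ring
  have hLlow : ∀ v : EuclideanSpace ℝ (Fin 3), ‖v‖ ≤ ‖L v‖ := by
    intro v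
    have : ‖v‖ ^ 2 ≤ ‖L v‖ ^ 2 := by rw [hLsq]; nlinarith [sq_nonneg ⟪v, e⟫]
    exact (sq_le_sq₀ (norm_nonneg _) (norm_nonneg _)).1 this
  have hLup : ∀ v : EuclideanSpace ℝ (Fin 3), ‖L v‖ ≤ 2 * ‖v‖ := by
    intro v
    have h2 : ⟪v, e⟫ ^ 2 ≤ ‖v‖ ^ 2 := by
      have h := abs_real_inner_le_norm v e
      rw [hee, mul_one] at h
      have h0 : 0 ≤ |⟪v, e⟫| := abs_nonneg _
      nlinarith [sq_abs ⟪v, e⟫]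
    have : ‖L v‖ ^ 2 ≤ (2 * ‖v‖) ^ 2 := by rw [hLsq]; nlinarith
    exact (sq_le_sq₀ (norm_nonneg _) (by positivity)).1 this
  have hLinj : Function.Injective L := by
    intro a b hab
    have h0 : L (a - b) = 0 := by rw [← hLsub, hab, sub_self]
    have := hLlow (a - b)
    rw [h0, norm_zero] at this
    exact sub_eq_zero.1 (norm_le_zero_iff.1 this)
  have hL0 : L 0 = 0 := by simp [hL]
  have hLe0 : L (EuclideanSpace.single (0 : Fin 3) (1:ℝ)) = EuclideanSpace.single (0 : Fin 3) (1:ℝ) := by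
    have : ⟪EuclideanSpace.single (0 : Fin 3) (1:ℝ), e⟫ = 0 := by
      rw [he, EuclideanSpace.inner_single_right]
      simp
    simp [hL, this]
  have hLe2 : L e = (2:ℝ) • e := by
    have : ⟪e, e⟫ = 1 := by rw [real_inner_self_eq_norm_sq, hee]; norm_num
    simp only [hL, this, one_smul, two_smul]
  have hinnerc : Continuous fun v : EuclideanSpace ℝ (Fin 3) => ⟪v, e⟫ := continuous_id.inner continuous_const
  have hLcont : Continuous L := continuous_id.add (hinnerc.smul continuous_const)
  -- the anisotropic free family
  set T : CorrFamily 3 := fun n x => gffFamily (1/2) n (fun i => L (x i)) with hT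
  have hmaps : ∀ n, MapsTo (fun (x : Fin n → EuclideanSpace ℝ (Fin 3)) i => L (x i))
      (NonCoincident 3 n) (NonCoincident 3 n) := by
    intro n x hx
    have hinj : Function.Injective x := hx
    show Function.Injective fun i => L (x i)
    exact hLinj.comp hinj
  have hsc : IsScaleCovariant (1/2) T := by
    intro n c hc x
    have := isScaleCovariant_gff (1/2) n c hc (fun i => L (x i))
    simp only [hT, hLsmul]
    exact this
  have hcont : ∀ n, ContinuousOn (T n) (NonCoincident 3 n) := by
    intro n
    refine (continuousOn_gffFamily (1/2) n).comp ?_ (hmaps n)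
    exact (continuous_pi fun i => hLcont.comp (continuous_apply i)).continuousOn
  have hlim : HasPointwiseScalingLimit (sampleOnLattice T) (fun δ => δ ^ (-(1/2:ℝ))) T :=
    hasPointwiseScalingLimit_sampleOnLattice hsc hcont
  have hT2 : ∀ x : Fin 2 → EuclideanSpace ℝ (Fin 3), T 2 x = gffTwo (1/2) (L (x 0)) (L (x 1)) := fun x => rfl
  have hnd : IsNondegenerateTwoPoint T := by
    intro x hx
    have hinj : Function.Injective x := hx
    rw [hT2]
    exact gffTwo_pos _ fun hEq => (by decide : (0 : Fin 2) ≠ 1) (hinj (hLinj hEq))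
  have hWick : ¬ HasNontrivialU4 T := by
    rintro ⟨x, -, hne⟩
    apply hne
    simp only [limitConnectedFour, hT, gffFamily, Matrix.cons_val_zero, Matrix.cons_val_one]
    ring
  have hG2 : ∀ x : Site 3, sampleOnLattice T 2 ![0, x] = ‖L (siteVec x)‖ ^ (-(1:ℝ)) := by
    intro x
    show gffTwo (1/2) (L (siteVec ((![0, x] : Fin 2 → Site 3) 0))) (L (siteVec ((![0, x] : Fin 2 → Site 3) 1))) = _
    simp only [Matrix.cons_val_zero, Matrix.cons_val_one]
    have h0 : siteVec (0 : Site 3) = 0 := by ext k; simp [siteVec_apply]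
    rw [gffTwo, h0, hL0, zero_sub, norm_neg, show (-(2 * (1/2 : ℝ))) = -1 by norm_num]
  -- feed the shadow statement
  refine hWick (h (sampleOnLattice T) ?_ ?_ (fun δ => δ ^ (-(1/2:ℝ))) T
    (fun δ hδ => Real.rpow_pos_of_pos hδ.1 _) hlim hnd ?_)
  · -- Coulomb lower bound: `‖L(siteVec x)‖ ≤ 2‖siteVec x‖ ≤ 4‖x‖`
    refine ⟨1/4, by norm_num, fun x hx => ?_⟩
    rw [hG2, Real.rpow_neg_one]
    have hx1 : (0:ℝ) < ‖x‖ := norm_pos_iff.2 hx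
    have hpos : 0 < ‖siteVec x‖ := hx1.trans_le (norm_le_norm_siteVec x)
    have hLpos : 0 < ‖L (siteVec x)‖ := hpos.trans_le (hLlow _)
    have h4 : ‖L (siteVec x)‖ ≤ 4 * ‖x‖ := (hLup _).trans (by linarith [norm_siteVec_le x])
    rw [div_le_iff₀ hx1, ← one_div, div_mul_eq_mul_div, one_mul, le_div_iff₀ hLpos]
    linarith
  · -- infrared upper bound: `‖x‖ ≤ ‖siteVec x‖ ≤ ‖L(siteVec x)‖`
    refine ⟨1, fun x hx => ?_⟩
    rw [hG2, Real.rpow_neg_one, one_div]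
    have hx1 : (0:ℝ) < ‖x‖ := norm_pos_iff.2 hx
    exact inv_anti₀ hx1 ((norm_le_norm_siteVec x).trans (hLlow _))
  · -- NonCoincident-inequivalent to every Möbius family: rotation `e₀ ↔ e₂`
    intro Δ S' hM heq
    have hrot := hM.1.2
    set R : EuclideanSpace ℝ (Fin 3) ≃ₗᵢ[ℝ] EuclideanSpace ℝ (Fin 3) :=
      LinearIsometryEquiv.piLpCongrLeft 2 ℝ ℝ (Equiv.swap (0 : Fin 3) 2) with hR
    set e₀ : EuclideanSpace ℝ (Fin 3) := EuclideanSpace.single (0 : Fin 3) (1:ℝ) with he₀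
    have hRe₀ : R e₀ = e := by
      rw [hR, he₀, he, EuclideanSpace.piLpCongrLeft_single]
      simp
    have hR0 : R 0 = 0 := map_zero R
    have he₀ne : (0 : EuclideanSpace ℝ (Fin 3)) ≠ e₀ := by
      intro h0
      have := congrArg (fun v : EuclideanSpace ℝ (Fin 3) => v 0) h0
      simp [he₀] at this
    have hene : (0 : EuclideanSpace ℝ (Fin 3)) ≠ e := by
      intro h0
      have := congrArg (fun v : EuclideanSpace ℝ (Fin 3) => v 2) h0
      simp [he] at this
    have hm₀ : (![0, e₀] : Fin 2 → EuclideanSpace ℝ (Fin 3)) ∈ NonCoincident 3 2 := pair_mem_nonCoincident he₀ne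
    have hm₂ : (![0, e] : Fin 2 → EuclideanSpace ℝ (Fin 3)) ∈ NonCoincident 3 2 := pair_mem_nonCoincident hene
    have hrot' := hrot 2 R ![0, e₀]
    have hcfg : (fun i => R ((![0, e₀] : Fin 2 → EuclideanSpace ℝ (Fin 3)) i)) = ![0, e] := by
      funext i
      fin_cases i <;> simp [hR0, hRe₀]
    rw [hcfg, ← heq 2 hm₂, ← heq 2 hm₀, hT2, hT2] at hrot'
    simp only [Matrix.cons_val_zero, Matrix.cons_val_one] at hrot'
    rw [hL0, hLe0, hLe2, gffTwo, gffTwo, zero_sub, zero_sub, norm_neg, norm_neg, norm_smul, he₀,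
      show (-(2 * (1/2 : ℝ))) = -1 by norm_num, Real.rpow_neg_one, Real.rpow_neg_one] at hrot'
    rw [← he₀] at hrot'
    have h1 : ‖e₀‖ = 1 := by simp [he₀]
    rw [hee, h1, Real.norm_eq_abs] at hrot'
    norm_num at hrot'

end Summit.CriticalPhenomena.Ising3DConformalLimit.PerfectScreeningCoulombImpliesNontrivial.CoulombBranchIsFree

end
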